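import Literature.Probability.LatticeModels.IsingTruncatedPairLowerBound
import Literature.Probability.LatticeModels.LebowitzProduct
import Literature.Probability.LatticeModels.IsingHighTemperatureEvenClustering
import HarnessLib

/-!
# The covariance of two spin products is controlled by the truncated two-point functions —
# ferromagnetic Ising model WITH a field ∕ plus boundary condition, GENERAL sets
# (Duminil-Copin–Goswami–Raoufi 2020, Lemma 1.2) — PROVED, by Ginibre's duplicated system

H. Duminil-Copin, S. Goswami, A. Raoufi, Comm. Math. Phys. **374** (2020) 891–921 = arXiv:1808.00439
[DuminilCopinGoswamiRaoufi2020], **Lemma 1.2** (p. 4 of the arXiv version): «For every finite graph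
`G`, every `β > β_c` and every two sets of vertices `A` and `B`, we have that
`0 ≤ ⟨σ_Aσ_B⟩⁺_{G,β} - ⟨σ_A⟩⁺_{G,β}⟨σ_B⟩⁺_{G,β} ≤ 2^{|A|+|B|-4} ∑_{a∈A, b∈B} ⟨σ_a;σ_b⟩⁺_{G,β}`»
(`⟨σ_a;σ_b⟩ = ⟨σ_aσ_b⟩ - ⟨σ_a⟩⟨σ_b⟩`; the printed proof, pp. 7–8, is by random currents on the
graph with a ghost vertex: switching lemma in the `𝓕_B` form, two cluster decompositions, and the
Edwards–Sokal bound `⟨σ_{A'∪B'}⟩ ≤ ∑ ⟨σ_aσ_b⟩` for odd `A'`, `B'`). The tree had the case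
`|A| = |B| = 2` (`IsingPairCovarianceBound.lean`, by Lebowitz' inequality). This file PROVES the
statement for all DISJOINT `A`, `B`, for the nearest-neighbour Ising model in a finite volume
`Λ ⊂ ℤ^d` with free or plus boundary condition and `β, h ≥ 0` (so in particular for the plus boxes
at `h = 0` of the source, at every `β`), with the constant `(|A|+|B|)!` in place of `2^{|A|+|B|-4}`:

  `0 ≤ ⟨σ_{A∪B}⟩ - ⟨σ_A⟩⟨σ_B⟩ ≤ (|A|+|B|)! · ∑_{a ∈ A} ∑_{b ∈ B} (⟨σ_aσ_b⟩ - ⟨σ_a⟩⟨σ_b⟩)`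

(`isingCorr_cov_disjoint_le_factorial_mul_sum_truncated`), and the same for the plus and free
infinite-volume states of `ℤ^d` (`plusCorr_cov_disjoint_le_factorial_mul_sum_truncated`,
`freeCorr_…`). No definition, no named fact.

## Proof (spin side; not the printed one)

Not random currents but **Ginibre's duplicated system** (Friedli–Velenik 2017, proof of Thm. 3.49,
p. 142; tree `gksSum_truncated_eq_sum_twisted`): with `τ = ωω'` the product of two independent copies,

  `Z² (⟨σ_Aσ_B⟩ - ⟨σ_A⟩⟨σ_B⟩) = ∑_τ (1 - τ_B) · Z_{K(1+τ)} ⟨σ_{A∪B}⟩_{K(1+τ)}`.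

For pair interactions and fields (`|Cᵢ| ≤ 2`) the diluted couplings `Kᵢ(1 + τ_{Cᵢ})` vanish on every
bond joining `R = {τ = -1}` to its complement and on every field term inside `R`; so the diluted
system is the independent product of a ZERO-FIELD ferromagnet on `R` and a system on `Rᶜ` (§1–§2:
`gksSum_spinProduct_mul_of_bipartition`, `gksSum_add_spinProduct_mul_of_subset`), whence
`⟨σ_{A∪B}⟩_{K(1+τ)} ≤ ⟨σ_{(A∪B)∩R}⟩^{R, h=0}` (GKS I on `Rᶜ`), which vanishes unless `|(A∪B)∩R|` is
even (spin flip on `R`). Since `τ_B = -1` forces `|B ∩ R|` odd, only `τ` with `|A∩R|`, `|B∩R|` BOTH ODD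
contribute, and for those the odd–odd bound of the zero-field system on `R`,
`⟨σ_{A'∪B'}⟩ ≤ (|A'|+|B'|)! ∑_{a∈A',b∈B'} ⟨σ_aσ_b⟩` (Newman's Gaussian inequality, tree
`isingCorr_free_oddUnion_le_factorial_mul` — for the Ising model on `ℤ^d` the zero-field system on `R`
IS the free-boundary model on the volume `R` at inverse temperature `2β`,
`isingCorr_free_eq_gksExpect_decoupled`), followed by the same factorisation read backwards
(`⟨σ_aσ_b⟩^{R} = ⟨σ_aσ_b⟩_{K(1+τ)}`, `(1 - τ_b) = 2` for `b ∈ R`) and Ginibre's identity for the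
pairs `{a}, {b}`, gives the claim (§3 abstract: `gksExpect_cov_le_mul_sum_truncated_of_oddOdd`; §4
Ising). The lower bound `0 ≤ …` is GKS II.

Purpose (cell `ym-ir`, census rows A5 ∕ A9): with the sheet duality of truncated Wilson-loop
correlations (`Z2Duality.znWilsonPairCov_eq_sum_plusCov`) this is the Ising input for the
CONFINED-phase exponential clustering of general rectangular Wilson loops of `ℤ₂` lattice gauge theory
on `ℤ³` modulo Duminil-Copin–Goswami–Raoufi's Thm 1.1
(`Literature/MathematicalPhysics/QuantumFieldTheory/IsingGaugeWilsonLoopCovarianceConfined.lean`).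
HONEST FRAMING: an Ising-model correlation inequality; nothing here bears on Yang–Mills or the mass
gap (Clay).

## References

* H. Duminil-Copin, S. Goswami, A. Raoufi, Comm. Math. Phys. 374 (2020) 891–921, arXiv:1808.00439,
  Lemma 1.2 (p. 4) and its proof (pp. 7–8). [DuminilCopinGoswamiRaoufi2020]
* S. Friedli, Y. Velenik, *Statistical Mechanics of Lattice Systems*, CUP (2017), §3.8.1 Thm. 3.49
  and its proof (pp. 141–142), Exercise 3.12 (p. 112). [FriedliVelenik2017]
* J. Ginibre, *General formulation of Griffiths' inequalities*, Comm. Math. Phys. 16 (1970) 310–328.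
* J. Glimm, A. Jaffe, *Quantum Physics*, 2nd ed. (1987), §17.2 Cor. 17.2.2; M. Aizenman, Comm. Math.
  Phys. 86 (1982), Prop. 12.1 (Gaussian inequality) — through `IsingHighTemperatureEvenClustering`.
  [GlimmJaffe1987]
-/

noncomputable section

open Finset Filter Topology
open scoped symmDiff

namespace Literature.Probability.LatticeModels

/-! ### §1 Independence across a bipartition of a generalised Ising system

For the spin system `ν_{Λ;K} ∝ exp{∑ᵢ Kᵢ ω_{Cᵢ}}` of Friedli–Velenik §3.8.1 (`gksSum`, `gksExpect`):
if the couplings split as `K = K₁ + K₂` with every nonzero `K₁`-term supported inside a set `R` and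
every nonzero `K₂`-term supported off `R`, the spins of `R` and `Rᶜ` are independent. -/

section Bipartition

variable {Λ : Type*} [Fintype Λ] [DecidableEq Λ] {ι : Type*}
variable (s : Finset ι) (C : ι → Finset Λ)

omit [Fintype Λ] in
/-- A spin product over `Y ⊆ R` only sees the spins of `R`. [folklore] -/
private theorem spinProduct_piecewise_of_subset {R Y : Finset Λ} (hY : Y ⊆ R) (σ σ' : SpinConfig Λ) :
    spinProduct Y (R.piecewise σ σ') = spinProduct Y σ := by
  unfold spinProduct
  refine Finset.prod_congr rfl fun x hx => ?_
  simp only [spinAt, Finset.piecewise_eq_of_mem _ _ _ (hY hx)]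

omit [Fintype Λ] in
/-- A spin product over a set disjoint from `R` only sees the spins off `R`. [folklore] -/
private theorem spinProduct_piecewise_of_disjoint {R Y : Finset Λ} (hY : Disjoint Y R) (σ σ' : SpinConfig Λ) :
    spinProduct Y (R.piecewise σ σ') = spinProduct Y σ' := by
  unfold spinProduct
  refine Finset.prod_congr rfl fun x hx => ?_
  simp only [spinAt, Finset.piecewise_eq_of_notMem _ _ _ (Finset.disjoint_left.1 hY hx)]

omit [Fintype Λ] [DecidableEq Λ] in
/-- The Boltzmann weight is multiplicative in the couplings: `e^{∑(K₁+K₂)ᵢω_{Cᵢ}} = e^{∑K₁…} e^{∑K₂…}`.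
[folklore] -/
private theorem gksWeight_add (K₁ K₂ : ι → ℝ) (σ : SpinConfig Λ) :
    gksWeight s (fun i => K₁ i + K₂ i) C σ = gksWeight s K₁ C σ * gksWeight s K₂ C σ := by
  unfold gksWeight gksHamiltonian
  rw [← Real.exp_add, ← Finset.sum_add_distrib]
  congr 1
  exact Finset.sum_congr rfl fun i _ => by ring

omit [Fintype Λ] [DecidableEq Λ] in
/-- If `K = K₁ + K₂` on the index set, the weight factorises (Friedli–Velenik 2017, §3.8.1: the
weight `exp{∑ K_C ω_C}` is a product over the interaction terms). [cite: FriedliVelenik2017, §3.8.1, p. 141] -/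
theorem gksWeight_split {K K₁ K₂ : ι → ℝ} (hK : ∀ i ∈ s, K i = K₁ i + K₂ i) (σ : SpinConfig Λ) :
    gksWeight s K C σ = gksWeight s K₁ C σ * gksWeight s K₂ C σ := by
  rw [← gksWeight_add]
  unfold gksWeight gksHamiltonian
  congr 1
  exact Finset.sum_congr rfl fun i hi => by rw [hK i hi]

omit [Fintype Λ] in
/-- Weights whose nonzero couplings are supported inside `R` depend only on the spins of `R`. [folklore] -/
private theorem gksWeight_piecewise_of_subset {R : Finset Λ} {K : ι → ℝ}
    (hK : ∀ i ∈ s, K i ≠ 0 → C i ⊆ R) (σ σ' : SpinConfig Λ) :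
    gksWeight s K C (R.piecewise σ σ') = gksWeight s K C σ := by
  unfold gksWeight gksHamiltonian
  congr 1
  refine Finset.sum_congr rfl fun i hi => ?_
  by_cases h0 : K i = 0
  · rw [h0, zero_mul, zero_mul]
  · rw [spinProduct_piecewise_of_subset (hK i hi h0)]

omit [Fintype Λ] in
/-- Weights whose nonzero couplings are supported off `R` depend only on the spins off `R`. [folklore] -/
private theorem gksWeight_piecewise_of_disjoint {R : Finset Λ} {K : ι → ℝ}
    (hK : ∀ i ∈ s, K i ≠ 0 → Disjoint (C i) R) (σ σ' : SpinConfig Λ) :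
    gksWeight s K C (R.piecewise σ σ') = gksWeight s K C σ' := by
  unfold gksWeight gksHamiltonian
  congr 1
  refine Finset.sum_congr rfl fun i hi => ?_
  by_cases h0 : K i = 0
  · rw [h0, zero_mul, zero_mul]
  · rw [spinProduct_piecewise_of_disjoint (hK i hi h0)]

/-- **The mixing identity.** If `u, v` depend only on the spins of `R` and `p, q` only on the spins off
`R`, then `(∑ u p)(∑ v q) = (∑ u q)(∑ v p)`: exchange the `Rᶜ`-parts of the two summation variables
(an involution of `Ω × Ω`) — the independence of `R` and `Rᶜ` once the couplings across `∂R` are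
switched off (Friedli–Velenik 2017, Exercise 3.12). [cite: FriedliVelenik2017, Exercise 3.12, p. 112] -/
theorem sum_mul_sum_eq_of_piecewise (R : Finset Λ) (u v p q : SpinConfig Λ → ℝ)
    (hu : ∀ σ σ', u (R.piecewise σ σ') = u σ) (hv : ∀ σ σ', v (R.piecewise σ σ') = v σ)
    (hp : ∀ σ σ', p (R.piecewise σ σ') = p σ') (hq : ∀ σ σ', q (R.piecewise σ σ') = q σ') :
    (∑ σ, u σ * p σ) * (∑ σ, v σ * q σ) = (∑ σ, u σ * q σ) * (∑ σ, v σ * p σ) := by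
  classical
  let Φ : SpinConfig Λ × SpinConfig Λ → SpinConfig Λ × SpinConfig Λ :=
    fun x => (R.piecewise x.1 x.2, R.piecewise x.2 x.1)
  have hΦ : Function.Involutive Φ := by
    intro x
    obtain ⟨σ, σ'⟩ := x
    simp only [Φ, Prod.mk.injEq]
    constructor
    · funext y
      by_cases hy : y ∈ R
      · rw [Finset.piecewise_eq_of_mem _ _ _ hy, Finset.piecewise_eq_of_mem _ _ _ hy]
      · rw [Finset.piecewise_eq_of_notMem _ _ _ hy, Finset.piecewise_eq_of_notMem _ _ _ hy]
    · funext y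
      by_cases hy : y ∈ R
      · rw [Finset.piecewise_eq_of_mem _ _ _ hy, Finset.piecewise_eq_of_mem _ _ _ hy]
      · rw [Finset.piecewise_eq_of_notMem _ _ _ hy, Finset.piecewise_eq_of_notMem _ _ _ hy]
  rw [Finset.sum_mul_sum, Finset.sum_mul_sum, ← Fintype.sum_prod_type', ← Fintype.sum_prod_type']
  refine (Fintype.sum_bijective Φ hΦ.bijective
    (fun x => u x.1 * q x.1 * (v x.2 * p x.2)) (fun x => u x.1 * p x.1 * (v x.2 * q x.2))
    fun x => ?_).symm
  obtain ⟨σ, σ'⟩ := x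
  simp only [Φ, hu, hv, hp, hq]
  ring

/-- **Independence, I**: for `Y ⊆ R`, `⟨σ_Y⟩_{K₁+K₂} = ⟨σ_Y⟩_{K₁}` (unnormalised form
`S_{K₁+K₂}(σ_Y) · Z_{K₁} = S_{K₁}(σ_Y) · Z_{K₁+K₂}`), when `K₁` lives inside `R` and `K₂` off `R`
(Friedli–Velenik 2017, Exercise 3.12: switching off the couplings across `∂R` decouples `R`).
[cite: FriedliVelenik2017, Exercise 3.12, p. 112] -/
theorem gksSum_add_spinProduct_mul_of_subset {R Y : Finset Λ} {K K₁ K₂ : ι → ℝ}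
    (hK : ∀ i ∈ s, K i = K₁ i + K₂ i)
    (h₁ : ∀ i ∈ s, K₁ i ≠ 0 → C i ⊆ R) (h₂ : ∀ i ∈ s, K₂ i ≠ 0 → Disjoint (C i) R) (hY : Y ⊆ R) :
    gksSum s K C (spinProduct Y) * gksSum s K₁ C (fun _ => 1) =
      gksSum s K₁ C (spinProduct Y) * gksSum s K C (fun _ => 1) := by
  simp only [gksSum, gksWeight_split s C hK, one_mul]
  have h := sum_mul_sum_eq_of_piecewise R
    (fun σ => spinProduct Y σ * gksWeight s K₁ C σ) (gksWeight s K₁ C) (gksWeight s K₂ C)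
    (fun _ => 1)
    (fun σ σ' => by rw [spinProduct_piecewise_of_subset hY, gksWeight_piecewise_of_subset s C h₁])
    (fun σ σ' => gksWeight_piecewise_of_subset s C h₁ σ σ')
    (fun σ σ' => gksWeight_piecewise_of_disjoint s C h₂ σ σ') (fun _ _ => rfl)
  simp only [mul_one] at h
  simpa only [mul_assoc] using h

/-- **Independence, II**: `⟨σ_X⟩ = ⟨σ_{X∩R}⟩ ⟨σ_{X∖R}⟩` under `K₁ + K₂` (unnormalised:
`S(σ_X) · Z = S(σ_{X∩R}) · S(σ_{X∖R})`), when `K₁` lives inside `R` and `K₂` off `R`.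
[cite: FriedliVelenik2017, Exercise 3.12, p. 112] -/
theorem gksSum_spinProduct_mul_of_bipartition {R : Finset Λ} {K K₁ K₂ : ι → ℝ}
    (hK : ∀ i ∈ s, K i = K₁ i + K₂ i)
    (h₁ : ∀ i ∈ s, K₁ i ≠ 0 → C i ⊆ R) (h₂ : ∀ i ∈ s, K₂ i ≠ 0 → Disjoint (C i) R) (X : Finset Λ) :
    gksSum s K C (spinProduct X) * gksSum s K C (fun _ => 1) =
      gksSum s K C (spinProduct (X ∩ R)) * gksSum s K C (spinProduct (X \ R)) := by
  have hX : spinProduct X = fun σ => spinProduct (X ∩ R) σ * spinProduct (X \ R) σ := by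
    funext σ
    rw [spinProduct_mul_eq_spinProduct_symmDiff]
    congr 1
    ext x
    simp only [Finset.mem_symmDiff, Finset.mem_inter, Finset.mem_sdiff]
    tauto
  simp only [gksSum, gksWeight_split s C hK, one_mul, hX]
  have h := sum_mul_sum_eq_of_piecewise R
    (fun σ => spinProduct (X ∩ R) σ * gksWeight s K₁ C σ) (gksWeight s K₁ C)
    (fun σ => spinProduct (X \ R) σ * gksWeight s K₂ C σ) (gksWeight s K₂ C)
    (fun σ σ' => by
      rw [spinProduct_piecewise_of_subset Finset.inter_subset_right,
        gksWeight_piecewise_of_subset s C h₁])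
    (fun σ σ' => gksWeight_piecewise_of_subset s C h₁ σ σ')
    (fun σ σ' => by
      rw [spinProduct_piecewise_of_disjoint (R := R) (Y := X \ R) Finset.sdiff_disjoint,
        gksWeight_piecewise_of_disjoint s C h₂])
    (fun σ σ' => gksWeight_piecewise_of_disjoint s C h₂ σ σ')
  have e1 : ∀ σ, spinProduct (X ∩ R) σ * spinProduct (X \ R) σ *
      (gksWeight s K₁ C σ * gksWeight s K₂ C σ) =
      spinProduct (X ∩ R) σ * gksWeight s K₁ C σ * (spinProduct (X \ R) σ * gksWeight s K₂ C σ) :=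
    fun σ => by ring
  have e2 : ∀ σ, spinProduct (X \ R) σ * (gksWeight s K₁ C σ * gksWeight s K₂ C σ) =
      gksWeight s K₁ C σ * (spinProduct (X \ R) σ * gksWeight s K₂ C σ) := fun σ => by ring
  have e3 : ∀ σ, spinProduct (X ∩ R) σ * (gksWeight s K₁ C σ * gksWeight s K₂ C σ) =
      spinProduct (X ∩ R) σ * gksWeight s K₁ C σ * gksWeight s K₂ C σ := fun σ => by ring
  simp only [e1, e2, e3]
  exact h

end Bipartition

/-! ### §2 Ginibre's duplicated system: the diluted couplings `Kᵢ(1 + τ_{Cᵢ})` and the region `R = {τ = -1}`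

For pair interactions and fields (`|Cᵢ| ≤ 2`), the diluted couplings split as `K^{in} + K^{out}` with
`K^{in}ᵢ = Kᵢ(1+τ_{Cᵢ}) 𝟙[Cᵢ ⊆ R]` supported inside `R` and EVEN (zero field on `R`), and `K^{out}`
supported off `R`. Throughout, `R = univ.filter (spinAt · τ = -1)` and the couplings are written out
(no new definition). -/

section Twisted

variable {Λ : Type*} [Fintype Λ] [DecidableEq Λ] {ι : Type*}
variable (s : Finset ι) (K : ι → ℝ) (C : ι → Finset Λ)

omit [DecidableEq Λ] in
/-- Off `R = {τ = -1}` the spin is `+1`. [folklore] -/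
private theorem spinAt_eq_one_of_not_mem_filter {τ : SpinConfig Λ} {x : Λ}
    (hx : x ∉ univ.filter fun y => spinAt y τ = -1) : spinAt x τ = 1 := by
  rcases spinAt_eq_one_or_eq_neg_one x τ with h | h
  · exact h
  · exact absurd (Finset.mem_filter.2 ⟨Finset.mem_univ x, h⟩) hx

/-- `τ_B = (-1)^{|B ∩ R|}` with `R = {τ = -1}`. [folklore] -/
private theorem spinProduct_eq_neg_one_pow_card_inter_filter (τ : SpinConfig Λ) (B : Finset Λ) :
    spinProduct B τ = (-1) ^ (B ∩ univ.filter fun y => spinAt y τ = -1).card := by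
  set R := univ.filter fun y => spinAt y τ = -1 with hR
  unfold spinProduct
  rw [← Finset.prod_filter_mul_prod_filter_not B (fun x => x ∈ R)]
  have h1 : ∏ x ∈ B.filter (fun x => x ∈ R), spinAt x τ = (-1) ^ (B ∩ R).card := by
    rw [Finset.filter_mem_eq_inter]
    exact Finset.prod_eq_pow_card fun x hx => (Finset.mem_filter.1 (Finset.mem_inter.1 hx).2).2
  have h2 : ∏ x ∈ B.filter (fun x => x ∉ R), spinAt x τ = 1 :=
    Finset.prod_eq_one fun x hx => spinAt_eq_one_of_not_mem_filter (Finset.mem_filter.1 hx).2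
  rw [h1, h2, mul_one]

/-- For `S ⊆ R = {τ = -1}`: `τ_S = (-1)^{|S|}`. [folklore] -/
private theorem spinProduct_eq_neg_one_pow_card_of_subset_filter (τ : SpinConfig Λ) {S : Finset Λ}
    (hS : S ⊆ univ.filter fun y => spinAt y τ = -1) : spinProduct S τ = (-1) ^ S.card := by
  rw [spinProduct_eq_neg_one_pow_card_inter_filter, Finset.inter_eq_left.2 hS]

/-- `τ_B = -1` forces `|B ∩ R|` odd. [folklore] -/
private theorem odd_card_inter_filter_of_spinProduct_eq_neg_one {τ : SpinConfig Λ} {B : Finset Λ}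
    (hB : spinProduct B τ = -1) : Odd (B ∩ univ.filter fun y => spinAt y τ = -1).card := by
  rcases Nat.even_or_odd (B ∩ univ.filter fun y => spinAt y τ = -1).card with h | h
  · rw [spinProduct_eq_neg_one_pow_card_inter_filter, h.neg_one_pow] at hB
    norm_num at hB
  · exact h

/-- **The inner couplings are supported inside `R`**: `K^{in}ᵢ ≠ 0 ⟹ Cᵢ ⊆ R` (the diluted couplings
`K_C(1+ω''_C)` of Friedli–Velenik 2017, proof of Thm. 3.49, restricted to `R`). [cite: FriedliVelenik2017, proof of Thm. 3.49, p. 142] -/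
theorem twistIn_subset (τ : SpinConfig Λ) :
    ∀ i ∈ s, (fun i => if C i ⊆ univ.filter (fun y => spinAt y τ = -1) then
        K i + K i * spinProduct (C i) τ else 0) i ≠ 0 →
      C i ⊆ univ.filter fun y => spinAt y τ = -1 := by
  intro i _ hne
  by_contra hsub
  exact hne (by simp only [hsub, if_false])

/-- **The outer couplings are supported off `R`** (pair interactions and fields, `|Cᵢ| ≤ 2`): a bond
joining `R` to `Rᶜ` has `τ_{Cᵢ} = -1`, i.e. diluted coupling `Kᵢ(1 + τ_{Cᵢ}) = 0`
(Friedli–Velenik 2017, proof of Thm. 3.49, p. 142, «coupling constants `K_C(1+ω''_C)`»).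
[cite: FriedliVelenik2017, proof of Thm. 3.49, p. 142] -/
theorem twistOut_disjoint (hC2 : ∀ i ∈ s, (C i).card ≤ 2) (τ : SpinConfig Λ) :
    ∀ i ∈ s, (fun i => if C i ⊆ univ.filter (fun y => spinAt y τ = -1) then 0 else
        K i + K i * spinProduct (C i) τ) i ≠ 0 →
      Disjoint (C i) (univ.filter fun y => spinAt y τ = -1) := by
  intro i hi hne
  set R := univ.filter fun y => spinAt y τ = -1 with hR
  by_cases hsub : C i ⊆ R
  · exact absurd (by simp only [hsub, if_true]) hne
  · have hne' : K i + K i * spinProduct (C i) τ ≠ 0 := by simpa only [hsub, if_false] using hne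
    obtain ⟨x, hxC, hxR⟩ := Finset.not_subset.1 hsub
    rw [Finset.disjoint_left]
    intro y hyC hyR
    have hxy : x ≠ y := fun h => hxR (h ▸ hyR)
    have hpair : ({x, y} : Finset Λ) = C i := by
      refine Finset.eq_of_subset_of_card_le (fun z hz => ?_) ?_
      · rcases Finset.mem_insert.1 hz with rfl | hz
        · exact hxC
        · rw [Finset.mem_singleton.1 hz]; exact hyC
      · rw [Finset.card_pair hxy]; exact hC2 i hi
    have hprod : spinProduct (C i) τ = -1 := by
      rw [← hpair, spinProduct, Finset.prod_pair hxy, spinAt_eq_one_of_not_mem_filter hxR,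
        (Finset.mem_filter.1 hyR).2, one_mul]
    exact hne' (by rw [hprod]; ring)

/-- **The inner couplings are even** (zero field on `R`): a field term `Cᵢ = {x}`, `x ∈ R`, has
diluted coupling `Kᵢ(1 + τ_x) = 0`, so every nonzero `K^{in}ᵢ` has `|Cᵢ| ∈ {0, 2}`.
[cite: FriedliVelenik2017, proof of Thm. 3.49, p. 142] -/
theorem twistIn_eq_zero_or_even (τ : SpinConfig Λ) :
    ∀ i ∈ s, (fun i => if C i ⊆ univ.filter (fun y => spinAt y τ = -1) then
        K i + K i * spinProduct (C i) τ else 0) i = 0 ∨ Even (C i).card := by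
  intro i hi
  by_cases hsub : C i ⊆ univ.filter (fun y => spinAt y τ = -1)
  · rcases Nat.even_or_odd (C i).card with he | ho
    · exact Or.inr he
    · left
      simp only [hsub, if_true]
      rw [spinProduct_eq_neg_one_pow_card_of_subset_filter τ hsub, ho.neg_one_pow]
      ring
  · left; simp only [hsub, if_false]

/-- The diluted couplings `K_C(1+ω''_C)` split as inner plus outer. [cite: FriedliVelenik2017, proof of Thm. 3.49, p. 142] -/
theorem twist_eq_twistIn_add_twistOut (τ : SpinConfig Λ) :
    ∀ i ∈ s, K i + K i * spinProduct (C i) τ =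
      (fun i => if C i ⊆ univ.filter (fun y => spinAt y τ = -1) then
          K i + K i * spinProduct (C i) τ else 0) i +
        (fun i => if C i ⊆ univ.filter (fun y => spinAt y τ = -1) then 0 else
          K i + K i * spinProduct (C i) τ) i := by
  intro i _
  by_cases h : C i ⊆ univ.filter (fun y => spinAt y τ = -1)
  · simp only [h, if_true, add_zero]
  · simp only [h, if_false, zero_add]

/-- The inner couplings are nonnegative for `K ≥ 0` («coupling constants `K_C(1 + ω''_C) ≥ 0`»). [cite: FriedliVelenik2017, proof of Thm. 3.49, p. 142] -/
theorem twistIn_nonneg (hK : ∀ i ∈ s, 0 ≤ K i) (τ : SpinConfig Λ) :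
    ∀ i ∈ s, 0 ≤ (fun i => if C i ⊆ univ.filter (fun y => spinAt y τ = -1) then
        K i + K i * spinProduct (C i) τ else 0) i := by
  intro i hi
  by_cases h : C i ⊆ univ.filter (fun y => spinAt y τ = -1)
  · simp only [h, if_true]; exact twisted_nonneg_of_nonneg s C hK τ i hi
  · simp only [h, if_false]; exact le_rfl

/-- `0 ≤ Z⟨σ_X⟩ ≤ Z` for `K ≥ 0` (GKS I and `|σ_X| ≤ 1`). [folklore] -/
private theorem gksSum_spinProduct_le_gksSum_one (X : Finset Λ) :
    gksSum s K C (spinProduct X) ≤ gksSum s K C (fun _ => 1) := by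
  unfold gksSum
  refine Finset.sum_le_sum fun σ _ => ?_
  rw [one_mul]
  have h1 : spinProduct X σ ≤ 1 := (le_abs_self _).trans (abs_spinProduct_le_one X σ)
  have hw := (gksWeight_pos s K C σ).le
  nlinarith

/-- **Independence for the diluted system, I**: for `Y ⊆ R`,
`Z_{K(1+τ)}⟨σ_Y⟩_{K(1+τ)} = ⟨σ_Y⟩_{K^{in}} · Z_{K(1+τ)}` (`|Cᵢ| ≤ 2`).
[cite: FriedliVelenik2017, proof of Thm. 3.49, p. 142; Exercise 3.12, p. 112] -/
theorem gksSum_twist_spinProduct_eq_gksExpect_twistIn_mul (hC2 : ∀ i ∈ s, (C i).card ≤ 2)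
    (τ : SpinConfig Λ) {Y : Finset Λ} (hY : Y ⊆ univ.filter fun y => spinAt y τ = -1) :
    gksSum s (fun i => K i + K i * spinProduct (C i) τ) C (spinProduct Y) =
      gksExpect s (fun i => if C i ⊆ univ.filter (fun y => spinAt y τ = -1) then
          K i + K i * spinProduct (C i) τ else 0) C (spinProduct Y) *
        gksSum s (fun i => K i + K i * spinProduct (C i) τ) C (fun _ => 1) := by
  classical
  have h := gksSum_add_spinProduct_mul_of_subset s C (twist_eq_twistIn_add_twistOut s K C τ)
    (twistIn_subset s K C τ) (twistOut_disjoint s K C hC2 τ) hY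
  have hZin := gksSum_one_pos s (fun i => if C i ⊆ univ.filter (fun y => spinAt y τ = -1) then
      K i + K i * spinProduct (C i) τ else 0) C
  rw [gksExpect, div_mul_eq_mul_div, eq_div_iff hZin.ne']
  exact h

/-- **Independence for the diluted system, II**: `Z⟨σ_X⟩ ≤ Z⟨σ_{X ∩ R}⟩` in the diluted system
`K(1+τ)` (`K ≥ 0`, `|Cᵢ| ≤ 2`): `⟨σ_X⟩ = ⟨σ_{X∩R}⟩⟨σ_{X∖R}⟩` and `0 ≤ ⟨σ_{X∖R}⟩ ≤ 1`.
[cite: FriedliVelenik2017, proof of Thm. 3.49, p. 142; Exercise 3.12, p. 112] -/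
theorem gksSum_twist_spinProduct_le_inter [DecidableEq ι] (hK : ∀ i ∈ s, 0 ≤ K i)
    (hC2 : ∀ i ∈ s, (C i).card ≤ 2) (τ : SpinConfig Λ) (X : Finset Λ) :
    gksSum s (fun i => K i + K i * spinProduct (C i) τ) C (spinProduct X) ≤
      gksSum s (fun i => K i + K i * spinProduct (C i) τ) C
        (spinProduct (X ∩ univ.filter fun y => spinAt y τ = -1)) := by
  set R := univ.filter fun y => spinAt y τ = -1 with hR
  have hKτ := twisted_nonneg_of_nonneg s C hK τ
  have h := gksSum_spinProduct_mul_of_bipartition s C (twist_eq_twistIn_add_twistOut s K C τ)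
    (twistIn_subset s K C τ) (twistOut_disjoint s K C hC2 τ) X
  rw [← hR] at h
  have hZ := gksSum_one_pos s (fun i => K i + K i * spinProduct (C i) τ) C
  have h1 : gksSum s (fun i => K i + K i * spinProduct (C i) τ) C (spinProduct (X \ R)) ≤
      gksSum s (fun i => K i + K i * spinProduct (C i) τ) C (fun _ => 1) :=
    gksSum_spinProduct_le_gksSum_one s _ C (X \ R)
  have h2 : 0 ≤ gksSum s (fun i => K i + K i * spinProduct (C i) τ) C (spinProduct (X ∩ R)) :=
    gksSum_spinProduct_nonneg s _ C hKτ (X ∩ R)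
  have h3 : gksSum s (fun i => K i + K i * spinProduct (C i) τ) C (spinProduct X) *
      gksSum s (fun i => K i + K i * spinProduct (C i) τ) C (fun _ => 1) ≤
      gksSum s (fun i => K i + K i * spinProduct (C i) τ) C (spinProduct (X ∩ R)) *
        gksSum s (fun i => K i + K i * spinProduct (C i) τ) C (fun _ => 1) := by
    rw [h]; exact mul_le_mul_of_nonneg_left h1 h2
  exact le_of_mul_le_mul_right h3 hZ

end Twisted

/-! ### §3 The covariance bound for generalised Ising systems with pair interactions and fields,
given the odd–odd bound for the zero-field systems on the regions `R` -/

section Abstract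

variable {Λ : Type*} [Fintype Λ] [DecidableEq Λ] {ι : Type*} [DecidableEq ι]
variable (s : Finset ι) (K : ι → ℝ) (C : ι → Finset Λ)

omit [Fintype Λ] in
/-- A pair is the symmetric difference of its singletons. [folklore] -/
private theorem pair_eq_symmDiff₀ {a b : Λ} (h : a ≠ b) : ({a, b} : Finset Λ) = {a} ∆ {b} := by
  ext z
  simp only [Finset.mem_insert, Finset.mem_singleton, Finset.mem_symmDiff]
  constructor
  · rintro (rfl | rfl)
    · exact Or.inl ⟨rfl, h⟩
    · exact Or.inr ⟨rfl, fun h' => h h'.symm⟩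
  · rintro (⟨h1, -⟩ | ⟨h1, -⟩)
    · exact Or.inl h1
    · exact Or.inr h1

/-- **One term of Ginibre's sum.** `K ≥ 0` on supports of at most two sites, `A, B` disjoint, `τ`
fixed, `R = {τ = -1}`; if the zero-field inner system on `R` satisfies the odd–odd bound
`⟨σ_{(A∪B)∩R}⟩_{K^{in}} ≤ c ∑_{a∈A∩R, b∈B∩R} ⟨σ_aσ_b⟩_{K^{in}}` whenever `|A∩R|`, `|B∩R|` are odd,
then `(1 - τ_B) Z_τ⟨σ_Aσ_B⟩_τ ≤ c ∑_{a∈A, b∈B} (1 - τ_b) Z_τ⟨σ_aσ_b⟩_τ` for the diluted system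
`τ ↦ K(1+τ)`. [cite: FriedliVelenik2017, proof of Thm. 3.49, p. 142; DuminilCopinGoswamiRaoufi2020 Lemma 1.2 (proof, pp. 7–8: parity and the odd–odd step)] -/
theorem twisted_term_le (hK : ∀ i ∈ s, 0 ≤ K i) (hC2 : ∀ i ∈ s, (C i).card ≤ 2)
    {A B : Finset Λ} (hAB : Disjoint A B) (τ : SpinConfig Λ) {c : ℝ} (hc : 0 ≤ c)
    (H : Odd (A ∩ univ.filter fun y => spinAt y τ = -1).card →
      Odd (B ∩ univ.filter fun y => spinAt y τ = -1).card →
      gksExpect s (fun i => if C i ⊆ univ.filter (fun y => spinAt y τ = -1) then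
          K i + K i * spinProduct (C i) τ else 0) C
          (spinProduct ((A ∪ B) ∩ univ.filter fun y => spinAt y τ = -1)) ≤
        c * ∑ a ∈ A ∩ univ.filter (fun y => spinAt y τ = -1),
          ∑ b ∈ B ∩ univ.filter (fun y => spinAt y τ = -1),
            gksExpect s (fun i => if C i ⊆ univ.filter (fun y => spinAt y τ = -1) then
              K i + K i * spinProduct (C i) τ else 0) C (spinProduct ({a} ∆ {b}))) :
    (1 - spinProduct B τ) *
        gksSum s (fun i => K i + K i * spinProduct (C i) τ) C (spinProduct (A ∆ B)) ≤
      c * ∑ a ∈ A, ∑ b ∈ B, (1 - spinProduct {b} τ) *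
        gksSum s (fun i => K i + K i * spinProduct (C i) τ) C (spinProduct ({a} ∆ {b})) := by
  set R := univ.filter fun y => spinAt y τ = -1 with hR
  set Kτ : ι → ℝ := fun i => K i + K i * spinProduct (C i) τ with hKτdef
  set Kin : ι → ℝ := fun i => if C i ⊆ R then K i + K i * spinProduct (C i) τ else 0 with hKindef
  have hKτ : ∀ i ∈ s, 0 ≤ Kτ i := twisted_nonneg_of_nonneg s C hK τ
  have hterm : ∀ a b : Λ, 0 ≤ (1 - spinProduct {b} τ) * gksSum s Kτ C (spinProduct ({a} ∆ {b})) :=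
    fun a b => mul_nonneg (one_sub_spinProduct_nonneg _ _) (gksSum_spinProduct_nonneg s Kτ C hKτ _)
  have hRHS : 0 ≤ c * ∑ a ∈ A, ∑ b ∈ B, (1 - spinProduct {b} τ) *
      gksSum s Kτ C (spinProduct ({a} ∆ {b})) :=
    mul_nonneg hc (Finset.sum_nonneg fun a _ => Finset.sum_nonneg fun b _ => hterm a b)
  rcases spinProduct_eq_one_or B τ with hB1 | hB1
  · rw [hB1, sub_self, zero_mul]; exact hRHS
  -- `τ_B = -1`: `|B ∩ R|` odd
  have hBodd : Odd (B ∩ R).card := odd_card_inter_filter_of_spinProduct_eq_neg_one hB1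
  have hAB' : A ∆ B = A ∪ B := hAB.symmDiff_eq_sup
  have hZ := gksSum_one_pos s Kτ C
  -- `Z⟨σ_{A∪B}⟩_τ ≤ Z⟨σ_{(A∪B)∩R}⟩_τ = ⟨σ_{(A∪B)∩R}⟩_{in} Z`
  have hle1 : gksSum s Kτ C (spinProduct (A ∪ B)) ≤ gksSum s Kτ C (spinProduct ((A ∪ B) ∩ R)) :=
    gksSum_twist_spinProduct_le_inter s K C hK hC2 τ (A ∪ B)
  have hin : ∀ Y : Finset Λ, Y ⊆ R →
      gksSum s Kτ C (spinProduct Y) = gksExpect s Kin C (spinProduct Y) * gksSum s Kτ C (fun _ => 1) :=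
    fun Y hY => gksSum_twist_spinProduct_eq_gksExpect_twistIn_mul s K C hC2 τ hY
  rw [hAB', hB1, sub_neg_eq_add, one_add_one_eq_two]
  rcases Nat.even_or_odd (A ∩ R).card with hAeven | hAodd
  · -- `|A ∩ R|` even: `|(A∪B)∩R|` odd, the inner correlation vanishes
    have hodd : Odd ((A ∪ B) ∩ R).card := by
      rw [Finset.union_inter_distrib_right,
        Finset.card_union_of_disjoint (hAB.mono Finset.inter_subset_left Finset.inter_subset_left)]
      exact hAeven.add_odd hBodd
    have h0 : gksSum s Kin C (spinProduct ((A ∪ B) ∩ R)) = 0 :=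
      gksSum_spinProduct_eq_zero_of_odd s Kin C (twistIn_eq_zero_or_even s K C τ) hodd
    have h0' : gksSum s Kτ C (spinProduct ((A ∪ B) ∩ R)) = 0 := by
      rw [hin _ Finset.inter_subset_right, gksExpect, h0, zero_div, zero_mul]
    have : gksSum s Kτ C (spinProduct (A ∪ B)) ≤ 0 := hle1.trans h0'.le
    linarith
  · -- both odd: the odd–odd hypothesis
    have hH := H hAodd hBodd
    have hE0 : ∀ a b : Λ, 0 ≤ gksExpect s Kin C (spinProduct ({a} ∆ {b})) :=
      fun a b => gksExpect_spinProduct_nonneg s Kin C (twistIn_nonneg s K C hK τ) _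
    calc 2 * gksSum s Kτ C (spinProduct (A ∪ B))
        ≤ 2 * gksSum s Kτ C (spinProduct ((A ∪ B) ∩ R)) := by linarith
      _ = 2 * (gksExpect s Kin C (spinProduct ((A ∪ B) ∩ R)) * gksSum s Kτ C (fun _ => 1)) := by
          rw [hin _ Finset.inter_subset_right]
      _ ≤ 2 * ((c * ∑ a ∈ A ∩ R, ∑ b ∈ B ∩ R, gksExpect s Kin C (spinProduct ({a} ∆ {b}))) *
            gksSum s Kτ C (fun _ => 1)) := by
          have := mul_le_mul_of_nonneg_right hH hZ.le
          linarith
      _ = c * ∑ a ∈ A ∩ R, ∑ b ∈ B ∩ R, 2 * gksSum s Kτ C (spinProduct ({a} ∆ {b})) := by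
          have e : ∀ a ∈ A ∩ R, ∀ b ∈ B ∩ R, 2 * gksSum s Kτ C (spinProduct ({a} ∆ {b})) =
              2 * gksSum s Kτ C (fun _ => 1) * gksExpect s Kin C (spinProduct ({a} ∆ {b})) := by
            intro a ha b hb
            have hab : ({a} : Finset Λ) ∆ {b} ⊆ R := by
              intro z hz
              rw [Finset.mem_symmDiff, Finset.mem_singleton, Finset.mem_singleton] at hz
              rcases hz with ⟨rfl, -⟩ | ⟨rfl, -⟩
              · exact (Finset.mem_inter.1 ha).2
              · exact (Finset.mem_inter.1 hb).2
            rw [hin _ hab]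
            ring
          rw [Finset.sum_congr rfl fun a ha => Finset.sum_congr rfl fun b hb => e a ha b hb]
          simp only [← Finset.mul_sum]
          ring
      _ = c * ∑ a ∈ A ∩ R, ∑ b ∈ B ∩ R, (1 - spinProduct {b} τ) *
            gksSum s Kτ C (spinProduct ({a} ∆ {b})) := by
          congr 1
          refine Finset.sum_congr rfl fun a _ => Finset.sum_congr rfl fun b hb => ?_
          have hb1 : spinProduct {b} τ = -1 := by
            rw [spinProduct, Finset.prod_singleton]
            exact (Finset.mem_filter.1 (Finset.mem_inter.1 hb).2).2
          rw [hb1]; norm_num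
      _ ≤ c * ∑ a ∈ A, ∑ b ∈ B, (1 - spinProduct {b} τ) *
            gksSum s Kτ C (spinProduct ({a} ∆ {b})) := by
          refine mul_le_mul_of_nonneg_left ?_ hc
          calc ∑ a ∈ A ∩ R, ∑ b ∈ B ∩ R, (1 - spinProduct {b} τ) * gksSum s Kτ C (spinProduct ({a} ∆ {b}))
              ≤ ∑ a ∈ A ∩ R, ∑ b ∈ B, (1 - spinProduct {b} τ) * gksSum s Kτ C (spinProduct ({a} ∆ {b})) :=
                Finset.sum_le_sum fun a _ => Finset.sum_le_sum_of_subset_of_nonneg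
                  Finset.inter_subset_left fun b _ _ => hterm a b
            _ ≤ ∑ a ∈ A, ∑ b ∈ B, (1 - spinProduct {b} τ) * gksSum s Kτ C (spinProduct ({a} ∆ {b})) :=
                Finset.sum_le_sum_of_subset_of_nonneg Finset.inter_subset_left
                  fun a _ _ => Finset.sum_nonneg fun b _ => hterm a b

/-- **The covariance of two spin products is controlled by the truncated two-point functions —
abstract form.** For the spin system `ν_{Λ;K}` with `Kᵢ ≥ 0` supported on at most two sites
(ferromagnetic pair interactions and nonnegative fields), disjoint `A, B`, and `c ≥ 0` such that for
every `τ` with `|A∩R|`, `|B∩R|` odd (`R = {τ = -1}`) the zero-field inner system `K^{in}_τ` obeys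
`⟨σ_{(A∪B)∩R}⟩ ≤ c ∑_{a∈A∩R,b∈B∩R} ⟨σ_aσ_b⟩`:
`⟨σ_Aσ_B⟩ - ⟨σ_A⟩⟨σ_B⟩ ≤ c ∑_{a∈A} ∑_{b∈B} (⟨σ_aσ_b⟩ - ⟨σ_a⟩⟨σ_b⟩)`
(Ginibre's identity `Z²Cov(σ_A,σ_B) = ∑_τ (1-τ_B) Z_τ⟨σ_{A∪B}⟩_τ` termwise, `twisted_term_le`, and
the same identity for the pairs). [cite: DuminilCopinGoswamiRaoufi2020, Lemma 1.2; FriedliVelenik2017 proof of Thm. 3.49, p. 142] -/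
theorem gksExpect_cov_le_mul_sum_truncated_of_oddOdd (hK : ∀ i ∈ s, 0 ≤ K i)
    (hC2 : ∀ i ∈ s, (C i).card ≤ 2) {A B : Finset Λ} (hAB : Disjoint A B) {c : ℝ} (hc : 0 ≤ c)
    (H : ∀ τ : SpinConfig Λ, Odd (A ∩ univ.filter fun y => spinAt y τ = -1).card →
      Odd (B ∩ univ.filter fun y => spinAt y τ = -1).card →
      gksExpect s (fun i => if C i ⊆ univ.filter (fun y => spinAt y τ = -1) then
          K i + K i * spinProduct (C i) τ else 0) C
          (spinProduct ((A ∪ B) ∩ univ.filter fun y => spinAt y τ = -1)) ≤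
        c * ∑ a ∈ A ∩ univ.filter (fun y => spinAt y τ = -1),
          ∑ b ∈ B ∩ univ.filter (fun y => spinAt y τ = -1),
            gksExpect s (fun i => if C i ⊆ univ.filter (fun y => spinAt y τ = -1) then
              K i + K i * spinProduct (C i) τ else 0) C (spinProduct ({a} ∆ {b}))) :
    gksExpect s K C (spinProduct (A ∆ B)) - gksExpect s K C (spinProduct A) * gksExpect s K C (spinProduct B) ≤
      c * ∑ a ∈ A, ∑ b ∈ B, (gksExpect s K C (spinProduct ({a} ∆ {b})) -
        gksExpect s K C (spinProduct {a}) * gksExpect s K C (spinProduct {b})) := by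
  set Z := gksSum s K C (fun _ => 1) with hZdef
  have hZ : 0 < Z := gksSum_one_pos s K C
  -- the unnormalised inequality
  have key : gksSum s K C (spinProduct (A ∆ B)) * Z - gksSum s K C (spinProduct A) * gksSum s K C (spinProduct B) ≤
      c * ∑ a ∈ A, ∑ b ∈ B, (gksSum s K C (spinProduct ({a} ∆ {b})) * Z -
        gksSum s K C (spinProduct {a}) * gksSum s K C (spinProduct {b})) := by
    rw [hZdef, gksSum_truncated_eq_sum_twisted s K C A B]
    have hrhs : ∀ a b : Λ, gksSum s K C (spinProduct ({a} ∆ {b})) * gksSum s K C (fun _ => 1) -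
        gksSum s K C (spinProduct {a}) * gksSum s K C (spinProduct {b}) =
        ∑ τ : SpinConfig Λ, (1 - spinProduct {b} τ) *
          gksSum s (fun i => K i + K i * spinProduct (C i) τ) C (spinProduct ({a} ∆ {b})) :=
      fun a b => gksSum_truncated_eq_sum_twisted s K C {a} {b}
    simp_rw [hrhs]
    have hcomm : ∑ a ∈ A, ∑ b ∈ B, ∑ τ : SpinConfig Λ, (1 - spinProduct {b} τ) *
        gksSum s (fun i => K i + K i * spinProduct (C i) τ) C (spinProduct ({a} ∆ {b})) =
        ∑ τ : SpinConfig Λ, ∑ a ∈ A, ∑ b ∈ B, (1 - spinProduct {b} τ) *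
          gksSum s (fun i => K i + K i * spinProduct (C i) τ) C (spinProduct ({a} ∆ {b})) := by
      calc _ = ∑ a ∈ A, ∑ τ : SpinConfig Λ, ∑ b ∈ B, (1 - spinProduct {b} τ) *
            gksSum s (fun i => K i + K i * spinProduct (C i) τ) C (spinProduct ({a} ∆ {b})) :=
            Finset.sum_congr rfl fun a _ => Finset.sum_comm
        _ = _ := Finset.sum_comm
    rw [hcomm, Finset.mul_sum]
    exact Finset.sum_le_sum fun τ _ => twisted_term_le s K C hK hC2 hAB τ hc (H τ)
  -- normalise by `Z²`
  refine le_of_mul_le_mul_right (a := Z ^ 2) ?_ (pow_pos hZ 2)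
  have e1 : (gksExpect s K C (spinProduct (A ∆ B)) -
      gksExpect s K C (spinProduct A) * gksExpect s K C (spinProduct B)) * Z ^ 2 =
      gksSum s K C (spinProduct (A ∆ B)) * Z - gksSum s K C (spinProduct A) * gksSum s K C (spinProduct B) := by
    simp only [gksExpect]
    rw [← hZdef]
    field_simp
  have e2 : c * (∑ a ∈ A, ∑ b ∈ B, (gksExpect s K C (spinProduct ({a} ∆ {b})) -
      gksExpect s K C (spinProduct {a}) * gksExpect s K C (spinProduct {b}))) * Z ^ 2 =
      c * ∑ a ∈ A, ∑ b ∈ B, (gksSum s K C (spinProduct ({a} ∆ {b})) * Z -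
        gksSum s K C (spinProduct {a}) * gksSum s K C (spinProduct {b})) := by
    rw [mul_assoc, Finset.sum_mul]
    congr 1
    refine Finset.sum_congr rfl fun a _ => ?_
    rw [Finset.sum_mul]
    refine Finset.sum_congr rfl fun b _ => ?_
    simp only [gksExpect]
    rw [← hZdef]
    field_simp
  rw [e1, e2]
  exact key

end Abstract

/-! ### §4 The Ising model in a volume of `ℤ^d`: the inner system is the free zero-field model on `R`
at inverse temperature `2β`, and the odd–odd hypothesis is Newman's Gaussian bound -/

section Ising

variable {V : Type*} [DecidableEq V]

omit [DecidableEq V] in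
/-- A point of `↥Λ` lies in the image of `R ⊆ ↥Λ` in `V` iff it lies in `R`. [folklore] -/
private theorem coe_mem_map_subtype_iff {Λ : Finset V} {R : Finset ↥Λ} {z : ↥Λ} :
    (z : V) ∈ R.map (Function.Embedding.subtype _) ↔ z ∈ R := by
  rw [Finset.mem_map]
  constructor
  · rintro ⟨w, hw, hwz⟩
    have : w = z := Subtype.ext hwz
    exact this ▸ hw
  · intro hz; exact ⟨z, hz, rfl⟩

omit [DecidableEq V] in
/-- Points of the image of `R ⊆ ↥Λ` lie in `Λ`. [folklore] -/
private theorem mem_of_mem_map_subtype {Λ : Finset V} {R : Finset ↥Λ} {v : V}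
    (hv : v ∈ R.map (Function.Embedding.subtype _)) : v ∈ Λ := by
  obtain ⟨w, -, rfl⟩ := Finset.mem_map.1 hv
  exact w.2

omit [DecidableEq V] in
/-- Membership of the image of `R ⊆ ↥Λ`: `v ∈ R'` iff `v ∈ Λ` and `⟨v, _⟩ ∈ R`. [folklore] -/
private theorem mem_map_subtype_iff {Λ : Finset V} {R : Finset ↥Λ} {v : V} :
    v ∈ R.map (Function.Embedding.subtype _) ↔ ∃ hv : v ∈ Λ, (⟨v, hv⟩ : ↥Λ) ∈ R := by
  constructor
  · intro hv
    exact ⟨mem_of_mem_map_subtype hv, (coe_mem_map_subtype_iff (z := ⟨v, mem_of_mem_map_subtype hv⟩)).1 hv⟩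
  · rintro ⟨hv, h⟩
    exact coe_mem_map_subtype_iff.2 h

/-- The image of `{a} ∆ {b} ⊆ ↥Λ` in `V` is `{a} ∆ {b}`. [folklore] -/
private theorem map_subtype_symmDiff_singleton {Λ : Finset V} (a b : ↥Λ) :
    (({a} : Finset ↥Λ) ∆ {b}).map (Function.Embedding.subtype _) = ({(a : V)} : Finset V) ∆ {(b : V)} := by
  ext v
  rw [mem_map_subtype_iff]
  simp only [Finset.mem_symmDiff, Finset.mem_singleton]
  constructor
  · rintro ⟨hv, h⟩
    rcases h with ⟨h1, h2⟩ | ⟨h1, h2⟩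
    · exact Or.inl ⟨by rw [← h1], fun h' => h2 (Subtype.ext (by simpa using h'))⟩
    · exact Or.inr ⟨by rw [← h1], fun h' => h2 (Subtype.ext (by simpa using h'))⟩
  · rintro (⟨rfl, h2⟩ | ⟨rfl, h2⟩)
    · exact ⟨a.2, Or.inl ⟨rfl, fun h' => h2 (congrArg Subtype.val h')⟩⟩
    · exact ⟨b.2, Or.inr ⟨rfl, fun h' => h2 (congrArg Subtype.val h')⟩⟩

variable {Λt : Type*} [Fintype Λt] [DecidableEq Λt] {ι : Type*}

/-- Expectations only depend on the couplings on the index set. [folklore] -/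
private theorem gksExpect_congr_coupling (s : Finset ι) {K K' : ι → ℝ} (C : ι → Finset Λt)
    (hK : ∀ i ∈ s, K i = K' i) (f : SpinConfig Λt → ℝ) : gksExpect s K C f = gksExpect s K' C f := by
  have hw : ∀ σ, gksWeight s K C σ = gksWeight s K' C σ := fun σ => by
    unfold gksWeight gksHamiltonian
    exact congrArg Real.exp (Finset.sum_congr rfl fun i hi => by rw [hK i hi])
  simp only [gksExpect, gksSum, hw]

/-- Membership in the support of an edge term. [folklore] -/
private theorem mem_isingSupp_inl_iff {Λ : Finset V} {e : Sym2 V} {z : ↥Λ} :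
    z ∈ isingSupp Λ (.inl e) ↔ (z : V) ∈ e := by
  simp [isingSupp]

/-- The support of a field term is a singleton. [folklore] -/
private theorem isingSupp_inr_eq {Λ : Finset V} {x : V} (hx : x ∈ Λ) :
    isingSupp Λ (.inr x) = {(⟨x, hx⟩ : ↥Λ)} := by
  ext z
  simp only [isingSupp, Finset.mem_filter, Finset.mem_univ, true_and, Finset.mem_singleton,
    Subtype.ext_iff]

variable (G : SimpleGraph V) [G.LocallyFinite]

/-- **The inner system of the Ising model is the free zero-field model on `R` at `2β`.** For the
finite-volume Ising model on `Λ` (free or plus b.c., field `h`) and a sign pattern `τ` with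
`R = {τ = -1}`, the inner diluted couplings `K^{in}_τ` coincide on the index set with the couplings
of the FREE model on the volume `R` at inverse temperature `2β` and field `0`
(`decoupledCoupling G R (2β) 0`): bonds inside `R` get `β(1 + τ_xτ_y) = 2β`, bonds across `∂R`
and field terms on `R` get `0`. [cite: FriedliVelenik2017, proof of Thm. 3.49, p. 142, and Exercise 3.12, p. 112] -/
theorem twistIn_ising_eq_decoupledCoupling {Λ : Finset V} (β h : ℝ) {bc : BoundaryCondition V}
    (hbc : bc = .free ∨ bc = .plus) (τ : SpinConfig ↥Λ) :
    ∀ i ∈ isingIdx G Λ,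
      (fun i => if isingSupp Λ i ⊆ univ.filter (fun y => spinAt y τ = -1) then
          gksCoupling G Λ β h bc i + gksCoupling G Λ β h bc i * spinProduct (isingSupp Λ i) τ
        else 0) i =
      decoupledCoupling G ((univ.filter fun y => spinAt y τ = -1).map (Function.Embedding.subtype _))
        (2 * β) 0 i := by
  set R := univ.filter fun y : ↥Λ => spinAt y τ = -1 with hR
  have hmemR : ∀ {z : ↥Λ}, z ∈ R ↔ spinAt z τ = -1 := fun {z} => by simp [hR]
  rintro (e | x) hi
  · -- an edge touching `Λ`
    rw [isingIdx, Finset.inl_mem_disjSum] at hi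
    have he := (mem_edgesTouching_iff (G := G)).1 hi
    simp only [decoupledCoupling]
    induction e using Sym2.ind with
    | _ x y =>
      have hxy : x ≠ y := G.ne_of_adj (by rw [← SimpleGraph.mem_edgeSet]; exact he.1)
      by_cases hboth : x ∈ R.map (Function.Embedding.subtype _) ∧ y ∈ R.map (Function.Embedding.subtype _)
      · -- a bond inside `R`: coupling `2β` on both sides
        obtain ⟨⟨hxΛ, hxR⟩, ⟨hyΛ, hyR⟩⟩ :
            (∃ hx : x ∈ Λ, (⟨x, hx⟩ : ↥Λ) ∈ R) ∧ ∃ hy : y ∈ Λ, (⟨y, hy⟩ : ↥Λ) ∈ R :=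
          ⟨mem_map_subtype_iff.1 hboth.1, mem_map_subtype_iff.1 hboth.2⟩
        have heIn : s(x, y) ∈ edgesIn G (R.map (Function.Embedding.subtype _)) := by
          rw [mem_edgesIn_iff]
          refine ⟨he.1, fun v hv => ?_⟩
          rcases Sym2.mem_iff.1 hv with rfl | rfl
          · exact hboth.1
          · exact hboth.2
        have heInΛ : s(x, y) ∈ edgesIn G Λ := by
          rw [mem_edgesIn_iff]
          refine ⟨he.1, fun v hv => ?_⟩
          rcases Sym2.mem_iff.1 hv with rfl | rfl
          · exact hxΛ
          · exact hyΛ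
        have hsub : isingSupp Λ (.inl s(x, y)) ⊆ R := by
          intro z hz
          rcases Sym2.mem_iff.1 (mem_isingSupp_inl_iff.1 hz) with h1 | h1
          · have : z = ⟨x, hxΛ⟩ := Subtype.ext h1
            rw [this]; exact hxR
          · have : z = ⟨y, hyΛ⟩ := Subtype.ext h1
            rw [this]; exact hyR
        have hprod : spinProduct (isingSupp Λ (.inl s(x, y))) τ = 1 := by
          rw [spinProduct_isingSupp_inl τ bc hxy, if_pos hxΛ, if_pos hyΛ, spinAt_glue_of_mem τ bc hxΛ,
            spinAt_glue_of_mem τ bc hyΛ, hmemR.1 hxR, hmemR.1 hyR]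
          norm_num
        simp only [hsub, if_true, heIn]
        rw [hprod, gksCoupling_inl_of_mem_edgesIn G β h hbc heInΛ]
        ring
      · -- not a bond inside `R`: both sides vanish
        have hnotIn : s(x, y) ∉ edgesIn G (R.map (Function.Embedding.subtype _)) := by
          intro hin
          rw [mem_edgesIn_iff] at hin
          exact hboth ⟨hin.2 x (Sym2.mem_mk_left x y), hin.2 y (Sym2.mem_mk_right x y)⟩
        simp only [hnotIn, if_false]
        by_cases hsub : isingSupp Λ (.inl s(x, y)) ⊆ R
        · simp only [hsub, if_true]
          -- some endpoint lies outside `Λ`, so the support is one site of `R`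
          have hx' : ∀ hx : x ∈ Λ, (⟨x, hx⟩ : ↥Λ) ∈ R := fun hx =>
            hsub (mem_isingSupp_inl_iff.2 (Sym2.mem_mk_left x y))
          have hy' : ∀ hy : y ∈ Λ, (⟨y, hy⟩ : ↥Λ) ∈ R := fun hy =>
            hsub (mem_isingSupp_inl_iff.2 (Sym2.mem_mk_right x y))
          have hnot : ¬(x ∈ Λ ∧ y ∈ Λ) := fun hxy2 =>
            hboth ⟨mem_map_subtype_iff.2 ⟨hxy2.1, hx' hxy2.1⟩, mem_map_subtype_iff.2 ⟨hxy2.2, hy' hxy2.2⟩⟩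
          have hprod : spinProduct (isingSupp Λ (.inl s(x, y))) τ = -1 := by
            rw [spinProduct_isingSupp_inl τ bc hxy]
            by_cases hx : x ∈ Λ
            · have hy : y ∉ Λ := fun hy => hnot ⟨hx, hy⟩
              rw [if_pos hx, if_neg hy, spinAt_glue_of_mem τ bc hx, hmemR.1 (hx' hx), mul_one]
            · have hy : y ∈ Λ := by
                obtain ⟨v, hvΛ, hv⟩ := he.2
                rcases Sym2.mem_iff.1 hv with rfl | rfl
                · exact absurd hvΛ hx
                · exact hvΛ
              rw [if_neg hx, if_pos hy, spinAt_glue_of_mem τ bc hy, hmemR.1 (hy' hy), one_mul]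
          rw [hprod]; ring
        · simp only [hsub, if_false]
  · -- a field term: support `{x}`, inner coupling `βh(1 + τ_x) 𝟙[x ∈ R] = 0`
    rw [isingIdx, Finset.inr_mem_disjSum] at hi
    have h0 : decoupledCoupling G (R.map (Function.Embedding.subtype _)) (2 * β) 0 (.inr x) = 0 := by
      simp only [decoupledCoupling, mul_zero, ite_self]
    rw [h0]
    by_cases hsub : isingSupp Λ (.inr x) ⊆ R
    · simp only [hsub, if_true]
      have hxR : (⟨x, hi⟩ : ↥Λ) ∈ R := hsub (by rw [isingSupp_inr_eq hi]; exact Finset.mem_singleton_self _)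
      rw [isingSupp_inr_eq hi, spinProduct, Finset.prod_singleton, hmemR.1 hxR]
      ring
    · simp only [hsub, if_false]

/-- **The inner expectations are free zero-field correlations on `R` at `2β`**: for `Y ⊆ R`,
`⟨σ_Y⟩_{K^{in}_τ} = ⟨σ_Y⟩^∅_{R; 2β, 0}`. [cite: FriedliVelenik2017, Exercise 3.12, p. 112] -/
theorem gksExpect_twistIn_ising_eq_isingCorr_free {Λ : Finset V} (β h : ℝ) {bc : BoundaryCondition V}
    (hbc : bc = .free ∨ bc = .plus) (τ : SpinConfig ↥Λ) {Y : Finset ↥Λ}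
    (hY : Y ⊆ univ.filter fun y => spinAt y τ = -1) :
    gksExpect (isingIdx G Λ)
        (fun i => if isingSupp Λ i ⊆ univ.filter (fun y => spinAt y τ = -1) then
          gksCoupling G Λ β h bc i + gksCoupling G Λ β h bc i * spinProduct (isingSupp Λ i) τ else 0)
        (isingSupp Λ) (spinProduct Y) =
      isingCorr G ((univ.filter fun y : ↥Λ => spinAt y τ = -1).map (Function.Embedding.subtype _))
        (2 * β) 0 .free (Y.map (Function.Embedding.subtype _)) := by
  have hR' : (univ.filter fun y : ↥Λ => spinAt y τ = -1).map (Function.Embedding.subtype _) ⊆ Λ :=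
    fun v hv => mem_of_mem_map_subtype hv
  have hY' : Y.map (Function.Embedding.subtype _) ⊆
      (univ.filter fun y : ↥Λ => spinAt y τ = -1).map (Function.Embedding.subtype _) :=
    Finset.map_subset_map.2 hY
  rw [isingCorr_free_eq_gksExpect_decoupled G hR' (2 * β) 0 hY', inVol_map]
  exact gksExpect_congr_coupling _ _ (twistIn_ising_eq_decoupledCoupling G β h hbc τ) _

variable {d : ℕ}

/-- **Duminil-Copin–Goswami–Raoufi 2020, Lemma 1.2, for general disjoint sets — finite volume.**
Nearest-neighbour Ising model in a finite volume `Λ ⊂ ℤ^d`, free or plus boundary condition,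
`β, h ≥ 0`, `A, B ⊆ Λ` disjoint (`σ_Aσ_B = σ_{A∆B}`):
`⟨σ_Aσ_B⟩ - ⟨σ_A⟩⟨σ_B⟩ ≤ (|A|+|B|)! · ∑_{a∈A} ∑_{b∈B} (⟨σ_aσ_b⟩ - ⟨σ_a⟩⟨σ_b⟩)`
(printed constant `2^{|A|+|B|-4}`, printed for the plus boxes at `h = 0`). Proof: Ginibre's
duplicated system (§3) with the odd–odd hypothesis discharged by Newman's Gaussian inequality for
the free zero-field model on `R` at `2β` (`isingCorr_free_oddUnion_le_factorial_mul`).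
[cite: DuminilCopinGoswamiRaoufi2020, Lemma 1.2; FriedliVelenik2017 proof of Thm. 3.49 (p. 142); GlimmJaffe1987 §17.2 Cor. 17.2.2] -/
theorem isingCorr_cov_disjoint_le_factorial_mul_sum_truncated {β h : ℝ} (hβ : 0 ≤ β) (hh : 0 ≤ h)
    {bc : BoundaryCondition (Site d)} (hbc : bc = .free ∨ bc = .plus) (Λ : Finset (Site d))
    {A B : Finset (Site d)} (hA : A ⊆ Λ) (hB : B ⊆ Λ) (hAB : Disjoint A B) :
    isingCorr (zdGraph d) Λ β h bc (A ∆ B) -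
        isingCorr (zdGraph d) Λ β h bc A * isingCorr (zdGraph d) Λ β h bc B ≤
      ((A.card + B.card).factorial : ℝ) * ∑ a ∈ A, ∑ b ∈ B,
        (isingCorr (zdGraph d) Λ β h bc ({a} ∆ {b}) -
          isingCorr (zdGraph d) Λ β h bc {a} * isingCorr (zdGraph d) Λ β h bc {b}) := by
  classical
  set G := zdGraph d with hG
  set s := isingIdx G Λ with hs
  set K := gksCoupling G Λ β h bc with hK'
  set C := isingSupp Λ with hC'
  have hK : ∀ i ∈ s, 0 ≤ K i := gksCoupling_nonneg G hβ hh hbc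
  have hC2 : ∀ i ∈ s, (C i).card ≤ 2 := fun i _ => card_isingSupp_le_two Λ i
  have hcorr : ∀ {X : Finset (Site d)}, X ⊆ Λ →
      isingCorr G Λ β h bc X = gksExpect s K C (spinProduct (inVol Λ X)) :=
    fun hX => isingCorr_eq_gksExpect G Λ β h bc hX
  have hsing : ∀ {u : Site d} (hu : u ∈ Λ), inVol Λ ({u} : Finset (Site d)) = {⟨u, hu⟩} := by
    intro u hu; ext z
    simp only [mem_inVol, Finset.mem_singleton, Subtype.ext_iff]
  -- rewrite every correlation through the dictionary
  have hABΛ : A ∆ B ⊆ Λ := (Finset.symmDiff_subset_union (s := A) (t := B)).trans (Finset.union_subset hA hB)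
  rw [hcorr hABΛ, hcorr hA, hcorr hB, inVol_symmDiff]
  have hrhs : ∑ a ∈ A, ∑ b ∈ B, (isingCorr G Λ β h bc ({a} ∆ {b}) -
        isingCorr G Λ β h bc {a} * isingCorr G Λ β h bc {b}) =
      ∑ a ∈ inVol Λ A, ∑ b ∈ inVol Λ B, (gksExpect s K C (spinProduct ({a} ∆ {b})) -
        gksExpect s K C (spinProduct {a}) * gksExpect s K C (spinProduct {b})) := by
    conv_lhs => rw [← map_inVol_of_subset hA]
    rw [Finset.sum_map]
    refine Finset.sum_congr rfl fun a ha => ?_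
    conv_lhs => rw [← map_inVol_of_subset hB]
    rw [Finset.sum_map]
    refine Finset.sum_congr rfl fun b hb => ?_
    have haΛ : (a : Site d) ∈ Λ := a.2
    have hbΛ : (b : Site d) ∈ Λ := b.2
    simp only [Function.Embedding.coe_subtype]
    rw [hcorr (X := {(a : Site d)} ∆ {(b : Site d)})
        ((Finset.symmDiff_subset_union (s := {(a : Site d)}) (t := {(b : Site d)})).trans
          (Finset.union_subset (Finset.singleton_subset_iff.2 haΛ) (Finset.singleton_subset_iff.2 hbΛ))),
      hcorr (Finset.singleton_subset_iff.2 haΛ), hcorr (Finset.singleton_subset_iff.2 hbΛ),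
      inVol_symmDiff, hsing haΛ, hsing hbΛ]
  rw [hrhs, ← card_inVol_of_subset hA, ← card_inVol_of_subset hB]
  have hABv : Disjoint (inVol Λ A) (inVol Λ B) := by
    rw [Finset.disjoint_left]
    intro z hzA hzB
    exact Finset.disjoint_left.1 hAB (mem_inVol.1 hzA) (mem_inVol.1 hzB)
  refine gksExpect_cov_le_mul_sum_truncated_of_oddOdd s K C hK hC2 hABv (by positivity) fun τ hAodd hBodd => ?_
  -- the odd–odd hypothesis: free zero-field model on `R'` at `2β`
  set R := univ.filter fun y : ↥Λ => spinAt y τ = -1 with hR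
  set emb := Function.Embedding.subtype fun x : Site d => x ∈ Λ with hemb
  set R' := R.map emb with hR'def
  set A₁ := (inVol Λ A ∩ R).map emb with hA₁
  set B₁ := (inVol Λ B ∩ R).map emb with hB₁
  have hbridge : ∀ Y : Finset ↥Λ, Y ⊆ R →
      gksExpect s (fun i => if C i ⊆ R then K i + K i * spinProduct (C i) τ else 0) C (spinProduct Y) =
        isingCorr G R' (2 * β) 0 .free (Y.map emb) :=
    fun Y hY => gksExpect_twistIn_ising_eq_isingCorr_free G β h hbc τ hY
  have hA₁R : A₁ ⊆ R' := Finset.map_subset_map.2 Finset.inter_subset_right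
  have hB₁R : B₁ ⊆ R' := Finset.map_subset_map.2 Finset.inter_subset_right
  have hdisj₁ : Disjoint A₁ B₁ :=
    (Finset.disjoint_map emb).2 (hABv.mono Finset.inter_subset_left Finset.inter_subset_left)
  have hA₁odd : Odd A₁.card := by rw [hA₁, Finset.card_map]; exact hAodd
  have hB₁odd : Odd B₁.card := by rw [hB₁, Finset.card_map]; exact hBodd
  have hβ2 : 0 ≤ 2 * β := by positivity
  -- the cross two-point functions of `R'` and their sum `M`
  have hpair : ∀ a ∈ inVol Λ A ∩ R, ∀ b ∈ inVol Λ B ∩ R,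
      gksExpect s (fun i => if C i ⊆ R then K i + K i * spinProduct (C i) τ else 0) C
          (spinProduct ({a} ∆ {b})) =
        isingCorr G R' (2 * β) 0 .free ({(a : Site d)} ∆ {(b : Site d)}) := by
    intro a ha b hb
    have hab : ({a} : Finset ↥Λ) ∆ {b} ⊆ R := by
      intro z hz
      rw [Finset.mem_symmDiff, Finset.mem_singleton, Finset.mem_singleton] at hz
      rcases hz with ⟨rfl, -⟩ | ⟨rfl, -⟩
      · exact (Finset.mem_inter.1 ha).2
      · exact (Finset.mem_inter.1 hb).2
    rw [hbridge _ hab, map_subtype_symmDiff_singleton]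
  set M := ∑ a ∈ A₁, ∑ b ∈ B₁, isingCorr G R' (2 * β) 0 .free ({a} ∆ {b}) with hM
  have hsumM : ∑ a ∈ inVol Λ A ∩ R, ∑ b ∈ inVol Λ B ∩ R,
      gksExpect s (fun i => if C i ⊆ R then K i + K i * spinProduct (C i) τ else 0) C
        (spinProduct ({a} ∆ {b})) = M := by
    rw [hM, hA₁, Finset.sum_map]
    refine Finset.sum_congr rfl fun a ha => ?_
    rw [hB₁, Finset.sum_map]
    refine Finset.sum_congr rfl fun b hb => ?_
    rw [hpair a ha b hb]
    rfl
  have hterm0 : ∀ a ∈ A₁, ∀ b ∈ B₁, 0 ≤ isingCorr G R' (2 * β) 0 .free ({a} ∆ {b}) := by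
    intro a ha b hb
    exact GKSInequalities.gks_one_holds G hβ2 le_rfl (Or.inl rfl)
      ((Finset.symmDiff_subset_union (s := {a}) (t := {b})).trans
        (Finset.union_subset (Finset.singleton_subset_iff.2 (hA₁R ha)) (Finset.singleton_subset_iff.2 (hB₁R hb))))
  have hM0 : 0 ≤ M := Finset.sum_nonneg fun a ha => Finset.sum_nonneg fun b hb => hterm0 a ha b hb
  have hMle : ∀ a ∈ A₁, ∀ b ∈ B₁, isingCorr G R' (2 * β) 0 .free ({a} ∆ {b}) ≤ M := by
    intro a ha b hb
    calc isingCorr G R' (2 * β) 0 .free ({a} ∆ {b})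
        ≤ ∑ b' ∈ B₁, isingCorr G R' (2 * β) 0 .free ({a} ∆ {b'}) :=
          Finset.single_le_sum (f := fun b' => isingCorr G R' (2 * β) 0 .free ({a} ∆ {b'}))
            (fun b' hb' => hterm0 a ha b' hb') hb
      _ ≤ M := Finset.single_le_sum (f := fun a' => ∑ b' ∈ B₁, isingCorr G R' (2 * β) 0 .free ({a'} ∆ {b'}))
            (fun a' ha' => Finset.sum_nonneg fun b' hb' => hterm0 a' ha' b' hb') ha
  -- Newman's Gaussian bound on `R'`
  have hgauss := isingCorr_free_oddUnion_le_factorial_mul (Λ := R') hβ2 hA₁R hB₁R hdisj₁ hA₁odd hB₁odd hM0 hMle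
  -- assemble
  have hY : (inVol Λ A ∪ inVol Λ B) ∩ R ⊆ R := Finset.inter_subset_right
  have hYmap : ((inVol Λ A ∪ inVol Λ B) ∩ R).map emb = A₁ ∪ B₁ := by
    rw [Finset.union_inter_distrib_right, Finset.map_union]
  rw [hbridge _ hY, hYmap, hsumM]
  refine hgauss.trans (mul_le_mul_of_nonneg_right ?_ hM0)
  have hcard : (A₁ ∪ B₁).card ≤ (inVol Λ A).card + (inVol Λ B).card := by
    calc (A₁ ∪ B₁).card ≤ A₁.card + B₁.card := Finset.card_union_le _ _
      _ = (inVol Λ A ∩ R).card + (inVol Λ B ∩ R).card := by rw [hA₁, hB₁, Finset.card_map, Finset.card_map]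
      _ ≤ (inVol Λ A).card + (inVol Λ B).card :=
          Nat.add_le_add (Finset.card_le_card Finset.inter_subset_left) (Finset.card_le_card Finset.inter_subset_left)
  exact_mod_cast Nat.factorial_le hcard

/-- **Duminil-Copin–Goswami–Raoufi 2020, Lemma 1.2 — both inequalities, finite volume**:
`0 ≤ ⟨σ_Aσ_B⟩ - ⟨σ_A⟩⟨σ_B⟩ ≤ (|A|+|B|)! ∑_{a∈A,b∈B} ⟨σ_a;σ_b⟩` for the free or plus boundary
condition, `β, h ≥ 0`, `A, B ⊆ Λ ⊂ ℤ^d` disjoint (the lower bound is GKS II).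
[cite: DuminilCopinGoswamiRaoufi2020, Lemma 1.2] -/
theorem isingCorr_cov_disjoint_mem_Icc {β h : ℝ} (hβ : 0 ≤ β) (hh : 0 ≤ h)
    {bc : BoundaryCondition (Site d)} (hbc : bc = .free ∨ bc = .plus) (Λ : Finset (Site d))
    {A B : Finset (Site d)} (hA : A ⊆ Λ) (hB : B ⊆ Λ) (hAB : Disjoint A B) :
    0 ≤ isingCorr (zdGraph d) Λ β h bc (A ∆ B) -
        isingCorr (zdGraph d) Λ β h bc A * isingCorr (zdGraph d) Λ β h bc B ∧
      isingCorr (zdGraph d) Λ β h bc (A ∆ B) -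
          isingCorr (zdGraph d) Λ β h bc A * isingCorr (zdGraph d) Λ β h bc B ≤
        ((A.card + B.card).factorial : ℝ) * ∑ a ∈ A, ∑ b ∈ B,
          (isingCorr (zdGraph d) Λ β h bc ({a} ∆ {b}) -
            isingCorr (zdGraph d) Λ β h bc {a} * isingCorr (zdGraph d) Λ β h bc {b}) :=
  ⟨sub_nonneg.2 (GKSInequalities.gks_two_holds (zdGraph d) hβ hh hbc hA hB),
    isingCorr_cov_disjoint_le_factorial_mul_sum_truncated hβ hh hbc Λ hA hB hAB⟩

end Ising

/-! ### §5 The plus and free states of `ℤ^d` -/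

section Zd

variable {d : ℕ}

/-- **Duminil-Copin–Goswami–Raoufi 2020, Lemma 1.2, for general disjoint sets — the PLUS state of
`ℤ^d`** (`β, h ≥ 0`; box limits of the finite-volume bound): for disjoint `A, B`,
`0 ≤ ⟨σ_Aσ_B⟩⁺ - ⟨σ_A⟩⁺⟨σ_B⟩⁺ ≤ (|A|+|B|)! ∑_{a∈A} ∑_{b∈B} (⟨σ_aσ_b⟩⁺ - ⟨σ_a⟩⁺⟨σ_b⟩⁺)`.
[cite: DuminilCopinGoswamiRaoufi2020, Lemma 1.2 (plus state)] -/
theorem plusCorr_cov_disjoint_le_factorial_mul_sum_truncated {β h : ℝ} (hβ : 0 ≤ β) (hh : 0 ≤ h)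
    {A B : Finset (Site d)} (hAB : Disjoint A B) :
    0 ≤ plusCorr d β h (A ∆ B) - plusCorr d β h A * plusCorr d β h B ∧
      plusCorr d β h (A ∆ B) - plusCorr d β h A * plusCorr d β h B ≤
        ((A.card + B.card).factorial : ℝ) * ∑ a ∈ A, ∑ b ∈ B,
          (plusCorr d β h ({a} ∆ {b}) - plusCorr d β h {a} * plusCorr d β h {b}) := by
  have hl : ∀ X : Finset (Site d), Tendsto (fun L : ℕ => isingCorr (zdGraph d) (box d L) β h .plus X)
      atTop (𝓝 (plusCorr d β h X)) := fun X => hasBoxLimit_isingCorr_plus_holds hβ hh X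
  have hL : Tendsto (fun L : ℕ => isingCorr (zdGraph d) (box d L) β h .plus (A ∆ B) -
      isingCorr (zdGraph d) (box d L) β h .plus A * isingCorr (zdGraph d) (box d L) β h .plus B) atTop
      (𝓝 (plusCorr d β h (A ∆ B) - plusCorr d β h A * plusCorr d β h B)) := (hl _).sub ((hl _).mul (hl _))
  have hR : Tendsto (fun L : ℕ => ((A.card + B.card).factorial : ℝ) * ∑ a ∈ A, ∑ b ∈ B,
      (isingCorr (zdGraph d) (box d L) β h .plus ({a} ∆ {b}) -
        isingCorr (zdGraph d) (box d L) β h .plus {a} * isingCorr (zdGraph d) (box d L) β h .plus {b})) atTop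
      (𝓝 (((A.card + B.card).factorial : ℝ) * ∑ a ∈ A, ∑ b ∈ B,
        (plusCorr d β h ({a} ∆ {b}) - plusCorr d β h {a} * plusCorr d β h {b}))) :=
    (tendsto_finsetSum _ fun a _ => tendsto_finsetSum _ fun b _ => (hl _).sub ((hl _).mul (hl _))).const_mul _
  obtain ⟨L₀, hL₀⟩ := exists_forall_subset_box d (A ∪ B)
  have hev : ∀ᶠ L : ℕ in atTop, A ⊆ box d L ∧ B ⊆ box d L := by
    filter_upwards [eventually_ge_atTop L₀] with L hLL
    exact ⟨Finset.subset_union_left.trans (hL₀ L hLL), Finset.subset_union_right.trans (hL₀ L hLL)⟩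
  refine ⟨ge_of_tendsto hL ?_, le_of_tendsto_of_tendsto hL hR ?_⟩
  · filter_upwards [hev] with L hLsub
    exact (isingCorr_cov_disjoint_mem_Icc hβ hh (Or.inr rfl) (box d L) hLsub.1 hLsub.2 hAB).1
  · filter_upwards [hev] with L hLsub
    exact (isingCorr_cov_disjoint_mem_Icc hβ hh (Or.inr rfl) (box d L) hLsub.1 hLsub.2 hAB).2

/-- **The same in the FREE state of `ℤ^d`** (`β, h ≥ 0`, disjoint `A, B`).
[cite: DuminilCopinGoswamiRaoufi2020, Lemma 1.2; GlimmJaffe1987 §17.2 Cor. 17.2.2] -/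
theorem freeCorr_cov_disjoint_le_factorial_mul_sum_truncated {β h : ℝ} (hβ : 0 ≤ β) (hh : 0 ≤ h)
    {A B : Finset (Site d)} (hAB : Disjoint A B) :
    0 ≤ freeCorr d β h (A ∆ B) - freeCorr d β h A * freeCorr d β h B ∧
      freeCorr d β h (A ∆ B) - freeCorr d β h A * freeCorr d β h B ≤
        ((A.card + B.card).factorial : ℝ) * ∑ a ∈ A, ∑ b ∈ B,
          (freeCorr d β h ({a} ∆ {b}) - freeCorr d β h {a} * freeCorr d β h {b}) := by
  have hl : ∀ X : Finset (Site d), Tendsto (fun L : ℕ => isingCorr (zdGraph d) (box d L) β h .free X)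
      atTop (𝓝 (freeCorr d β h X)) := fun X => hasBoxLimit_isingCorr_free_holds hβ hh X
  have hL : Tendsto (fun L : ℕ => isingCorr (zdGraph d) (box d L) β h .free (A ∆ B) -
      isingCorr (zdGraph d) (box d L) β h .free A * isingCorr (zdGraph d) (box d L) β h .free B) atTop
      (𝓝 (freeCorr d β h (A ∆ B) - freeCorr d β h A * freeCorr d β h B)) := (hl _).sub ((hl _).mul (hl _))
  have hR : Tendsto (fun L : ℕ => ((A.card + B.card).factorial : ℝ) * ∑ a ∈ A, ∑ b ∈ B,
      (isingCorr (zdGraph d) (box d L) β h .free ({a} ∆ {b}) -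
        isingCorr (zdGraph d) (box d L) β h .free {a} * isingCorr (zdGraph d) (box d L) β h .free {b})) atTop
      (𝓝 (((A.card + B.card).factorial : ℝ) * ∑ a ∈ A, ∑ b ∈ B,
        (freeCorr d β h ({a} ∆ {b}) - freeCorr d β h {a} * freeCorr d β h {b}))) :=
    (tendsto_finsetSum _ fun a _ => tendsto_finsetSum _ fun b _ => (hl _).sub ((hl _).mul (hl _))).const_mul _
  obtain ⟨L₀, hL₀⟩ := exists_forall_subset_box d (A ∪ B)
  have hev : ∀ᶠ L : ℕ in atTop, A ⊆ box d L ∧ B ⊆ box d L := by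
    filter_upwards [eventually_ge_atTop L₀] with L hLL
    exact ⟨Finset.subset_union_left.trans (hL₀ L hLL), Finset.subset_union_right.trans (hL₀ L hLL)⟩
  refine ⟨ge_of_tendsto hL ?_, le_of_tendsto_of_tendsto hL hR ?_⟩
  · filter_upwards [hev] with L hLsub
    exact (isingCorr_cov_disjoint_mem_Icc hβ hh (Or.inl rfl) (box d L) hLsub.1 hLsub.2 hAB).1
  · filter_upwards [hev] with L hLsub
    exact (isingCorr_cov_disjoint_mem_Icc hβ hh (Or.inl rfl) (box d L) hLsub.1 hLsub.2 hAB).2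

end Zd

end Literature.Probability.LatticeModels
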